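import Summits.AtomisticToContinuum.Crystallization.Theorems.ChartedPlanarOrderMesoCut

/-!
# (B′.7b) ZZZH — SHADOW TRANSFER OF TWO-SHELL GOODNESS (the first lemma of (CC); 3 theorems, 0 def)

Lineage `stmt-AtomisticToContinuum-26636` (route ChartedPlanarOrder), lens-2 g82; piece (CC) `PlacedCrystalChartP` of ZZZG.  The special class
(cool shadow crystals) is defined by a TWO-SIDED TRANSLATION SHADOW (`EnvClose ϑr Rs C c H x`: the `Rs`-environment of `c` in `C` and the
`Rs`-environment of `x` in `H` are `ϑr`-close after translating both centres to the origin).  This file proves that two-shell goodness crosses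
such a shadow at the price of the tolerance and of the lower scale:

* ★ `isTwoShellGoodSet_of_envClose` — `H` is `(θ, aLo, aHi)`-two-shell-good at `x`, `C` is `σC`-separated with `2τ < σC`, `c ∈ C`, and
  `EnvClose τ R C c H x` with `R ≥ (3/2)·aHi` ⟹ `C` is `(θ', aLo − τ, aHi)`-two-shell-good at `c` for every `θ' ≥ θ` with
  `τ·(5/2 + θ') ≤ (θ' − θ)·aLo` (and `θ ≤ 1/12`, `2τ < aLo(1 − 2θ)`).  MECHANISM: push the pattern assignment `f` of `x` through the shadow
  (`g ∘ f`, `g` = the `C`-partner of an `H`-atom within `R` of `x`); the SCALE DROPS from `a` to `a − τ` so that the two-sidedness ball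
  `3(a − τ)/2` of `c`, pulled back through the shadow (`+ τ`), stays inside the two-sidedness ball `3a/2` of `x`; the fit error is
  `τ + θa + τ‖v‖ ≤ θa + (5/2)τ` (pattern norms `≤ √2 ≤ 3/2`); injectivity from the `a(1 − 2θ)`-separation of matched atoms (`> 2τ`); two-sidedness from
  the `σC`-separation of `C` (`> 2τ`).
* `isTwoShellGoodSet_of_envClose_record` — the record instance `(θ, aLo, aHi, τ, R) = (1/16, 9/10, 1, 10⁻⁴, 5)`, `σC = 17/20`: the shadow is
  `(1/15, 8999/10000, 1)`-good (indeed `(1/16 + 1/2000, …)`-good; `1/15` is the dial of the sequel's gluing port).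

0 sorry; no new definitions; no instance, no notation.  [folklore matching argument; HalesDSP2012 §1.3 for the patterns]
-/

noncomputable section
open Set Metric
open Literature.Geometry.DiscreteGeometry

namespace Summit.AtomisticToContinuum.Crystallization.Theorems.ChartedZeroExcessLayeredLatticeLiouville

open Summit.AtomisticToContinuum.Crystallization.Theorems.ChartedPlanarOrderRigidityDoor (E3)
open Summit.AtomisticToContinuum.Crystallization.Theorems.ChartedPlanarOrderDensityDichotomy (IsSep)
open Summit.AtomisticToContinuum.Crystallization.Theorems.ChartedPlanarOrderMesoCut (EnvClose)

/-- distinct points of either two-shell pattern are at distance `≥ 1`. [cite: HalesDSP2012, §1.3] -/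
theorem one_le_dist_of_mem_twoShellPattern {P : Finset E3} (hP : P = fccTwoShellPattern ∨ P = hcpTwoShellPattern) {v w : E3}
    (hv : v ∈ P) (hw : w ∈ P) (hne : v ≠ w) : 1 ≤ dist v w := by
  rcases hP with rfl | rfl
  · exact one_le_dist_of_mem_fccTwoShellPattern hv hw hne
  · exact one_le_dist_of_mem_hcpTwoShellPattern hv hw hne

/-- ★ **SHADOW TRANSFER OF TWO-SHELL GOODNESS** (see the module docstring). [folklore] -/
theorem isTwoShellGoodSet_of_envClose {θ θ' aLo aHi τ R σC : ℝ} {H C : Set E3} {x c : E3}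
    (haLo : 0 < aLo) (hθ12 : θ ≤ 1 / 12) (hτ : 0 ≤ τ) (hθθ' : θ ≤ θ')
    (hfit : τ * (5 / 2 + θ') ≤ (θ' - θ) * aLo) (hinj : 2 * τ < aLo * (1 - 2 * θ)) (hσ : 2 * τ < σC) (hR : 3 / 2 * aHi ≤ R)
    (hgood : IsTwoShellGoodSet θ aLo aHi H x) (hsepC : IsSep σC C) (hc : c ∈ C) (hE : EnvClose τ R C c H x) :
    IsTwoShellGoodSet θ' (aLo - τ) aHi C c := by
  classical
  obtain ⟨a, haLo', haHi', A, P, f, hP, hf, hfinj, hsurj⟩ := hgood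
  have ha0 : 0 < a := haLo.trans_le haLo'
  have hs2 : Real.sqrt 2 ≤ 17 / 12 := by
    rw [Real.sqrt_le_left (by norm_num)]
    norm_num
  -- the shadow partner of an `H`-atom within `R` of `x`
  choose! g hgC hgτ using hE.2
  -- ideal positions
  have hideal : ∀ v : E3, dist (x + a • A v) x = a * ‖v‖ := fun v => by
    rw [dist_eq_norm, add_sub_cancel_left, norm_smul, Real.norm_of_nonneg ha0.le, A.norm_map]
  have hnormv : ∀ v ∈ P, ‖v‖ ≤ 3 / 2 := fun v hv => (norm_le_sqrt_two_of_mem_twoShellPattern hP hv).trans (by linarith)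
  -- matched atoms lie within `3a/2 ≤ R` of `x`
  have hfR : ∀ v ∈ P, dist (f v) x ≤ R := fun v hv => by
    have h1 := (hf v hv).2
    have h2 := hideal v
    have h3 : a * ‖v‖ ≤ a * (17 / 12) :=
      mul_le_mul_of_nonneg_left ((norm_le_sqrt_two_of_mem_twoShellPattern hP hv).trans hs2) ha0.le
    have h4 : θ * a ≤ 1 / 12 * a := mul_le_mul_of_nonneg_right hθ12 ha0.le
    have h5 : a ≤ aHi := haHi'
    linarith [dist_triangle (f v) (x + a • A v) x]
  refine ⟨a - τ, by linarith, by linarith, A, P, g ∘ f, hP, fun v hv => ⟨hgC _ (hf v hv).1 (hfR v hv), ?_⟩, ?_, ?_⟩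
  · -- the fit at scale `a − τ`
    have hv1 := (hf v hv).1
    have hv2 := (hf v hv).2
    have hgv := hgτ _ hv1 (hfR v hv)
    have e1 : dist (g (f v)) (c + (f v - x)) = dist (g (f v) - c) (f v - x) := by
      rw [dist_eq_norm, dist_eq_norm, sub_add_eq_sub_sub]
    have e2 : dist (c + (f v - x)) (c + a • A v) = dist (f v) (x + a • A v) := by
      rw [dist_eq_norm, dist_eq_norm, add_sub_add_left_eq_sub, sub_sub, add_comm x]
    have e3 : dist (c + a • A v) (c + (a - τ) • A v) = τ * ‖v‖ := by
      rw [dist_eq_norm, add_sub_add_left_eq_sub, ← sub_smul, sub_sub_cancel, norm_smul, Real.norm_of_nonneg hτ, A.norm_map]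
    have h3 : τ * ‖v‖ ≤ τ * (3 / 2) := mul_le_mul_of_nonneg_left (hnormv v hv) hτ
    have h4 : (θ' - θ) * aLo ≤ (θ' - θ) * a := mul_le_mul_of_nonneg_left haLo' (sub_nonneg.2 hθθ')
    show dist (g (f v)) (c + (a - τ) • A v) ≤ θ' * (a - τ)
    calc dist (g (f v)) (c + (a - τ) • A v)
        ≤ dist (g (f v)) (c + (f v - x)) + dist (c + (f v - x)) (c + a • A v) + dist (c + a • A v) (c + (a - τ) • A v) :=
          dist_triangle4 _ _ _ _
      _ = dist (g (f v) - c) (f v - x) + dist (f v) (x + a • A v) + τ * ‖v‖ := by rw [e1, e2, e3]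
      _ ≤ τ + θ * a + τ * (3 / 2) := by linarith
      _ ≤ θ' * (a - τ) := by nlinarith
  · -- injectivity on the pattern
    intro v hv w hw hgg
    by_contra hne
    have hfne : f v ≠ f w := fun h => hne (hfinj hv hw h)
    have hlow : a * 1 - 2 * (θ * a) ≤ dist (f v) (f w) := by
      have h1 := one_le_dist_of_mem_twoShellPattern hP hv hw hne
      have h2 : dist (x + a • A v) (x + a • A w) = a * dist v w := by
        rw [dist_eq_norm, add_sub_add_left_eq_sub, ← smul_sub, ← map_sub, norm_smul, Real.norm_of_nonneg ha0.le, A.norm_map,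
          dist_eq_norm]
      have h3 : a * 1 ≤ a * dist v w := mul_le_mul_of_nonneg_left h1 ha0.le
      linarith [dist_triangle4 (x + a • A v) (f v) (f w) (x + a • A w), (hf v hv).2, (hf w hw).2, dist_comm (f v) (x + a • A v)]
    have hup : dist (f v) (f w) ≤ 2 * τ := by
      have h1 := hgτ _ (hf v hv).1 (hfR v hv)
      have h2 := hgτ _ (hf w hw).1 (hfR w hw)
      have e : dist (f v) (f w) = dist (f v - x) (f w - x) := by rw [dist_sub_right]
      have hgg' : g (f v) = g (f w) := hgg
      rw [hgg'] at h1
      rw [e]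
      linarith [dist_triangle (f v - x) (g (f w) - c) (f w - x), dist_comm (g (f w) - c) (f v - x)]
    have h4 : aLo * (1 - 2 * θ) ≤ a * (1 - 2 * θ) := mul_le_mul_of_nonneg_right haLo' (by linarith)
    nlinarith
  · -- two-sidedness within `3(a − τ)/2` of `c`
    intro y hy hyc hyd
    have hyR : dist y c ≤ R := by nlinarith
    obtain ⟨q, hqH, hqτ⟩ := hE.1 y hy hyR
    have hycσ : σC ≤ dist y c := hsepC y hy c hc hyc
    have hqx : q ≠ x := by
      rintro rfl
      rw [sub_self, dist_eq_norm, sub_zero, ← dist_eq_norm] at hqτ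
      linarith
    have hqd : dist q x ≤ 3 / 2 * a := by
      have h1 : ‖q - x‖ ≤ ‖(q - x) - (y - c)‖ + ‖y - c‖ := norm_le_norm_sub_add _ _
      rw [← dist_eq_norm, ← dist_eq_norm, ← dist_eq_norm, dist_comm (q - x) (y - c)] at h1
      linarith
    have hqR : dist q x ≤ R := by nlinarith
    obtain ⟨v, hv, hfv⟩ := hsurj q hqH hqx hqd
    refine ⟨v, hv, ?_⟩
    show g (f v) = y
    rw [hfv]
    by_contra hne
    have hsep := hsepC (g q) (hgC q hqH hqR) y hy hne
    have h1 := hgτ q hqH hqR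
    have e : dist (g q) y = dist (g q - c) (y - c) := by rw [dist_sub_right]
    have h2 : dist (g q - c) (y - c) ≤ 2 * τ := by
      linarith [dist_triangle (g q - c) (q - x) (y - c), dist_comm (y - c) (q - x)]
    linarith

/-- ★ **THE RECORD INSTANCE**: a `17/20`-separated two-sided `(10⁻⁴, 5)`-shadow of a `(1/16, 9/10, 1)`-good atom is `(1/15, 8999/10000, 1)`-good.
[this file, g82] -/
theorem isTwoShellGoodSet_of_envClose_record {H C : Set E3} {x c : E3} (hgood : IsTwoShellGoodSet (1 / 16) (9 / 10) 1 H x)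
    (hsepC : IsSep (17 / 20) C) (hc : c ∈ C) (hE : EnvClose (1 / 10000) 5 C c H x) :
    IsTwoShellGoodSet (1 / 15) (8999 / 10000) 1 C c := by
  have h := isTwoShellGoodSet_of_envClose (θ' := 1 / 15) (by norm_num) (by norm_num) (by norm_num) (by norm_num) (by norm_num) (by norm_num)
    (by norm_num) (by norm_num) hgood hsepC hc hE
  norm_num at h
  exact h

end Summit.AtomisticToContinuum.Crystallization.Theorems.ChartedZeroExcessLayeredLatticeLiouville

end
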